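import Mathlib
import Literature.Analysis.FluidPDE.TypeIICoreWitness
import HarnessLib

/-!
# Crux `MonopoleCoreExclusion` (stmt-1965): kinematic obstruction for the anchor stub of the AXISYMMETRIC class —
# part 1: elementary geometry of `rotZ π`, on-axis verticality, and the quantitative lemmas

`--supports stmt-NavierStokesRegularity-1965` (helper file, negative side; theorems only, no definitions, no `sorry`).
Companion of `…MonopoleCoreExclusionAnchorObstruction` (the obstruction theorem) — split off to respect the 400-line
limit.  Contents: `‖R_π y - y‖ = 2 r(y)`; points on the axis are fixed by `rotZ`; ON THE AXIS AN AXISYMMETRIC FIELD IS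
VERTICAL; the cylindrical radius is `1`-Lipschitz; `‖e_z - e_x‖² = 2`; two component bounds
extracted from `C⁰`-closeness; "two orthonormal vectors cannot both be `O(1/K)`-close to vertical for `K ≥ 25`"; and
the sizes of the core-plus-shell slice.  Nothing about Navier–Stokes is claimed.
-/

noncomputable section

open Set Metric
open Literature.Analysis Literature.Analysis.FluidPDE

namespace Summit.NavierStokesRegularity.NavierStokesRegularity.Theorems

-- the problem directory repeats the summit name (`NavierStokesRegularity/NavierStokesRegularity`)
set_option linter.dupNamespace false

namespace MonopoleAnchorObstruction

/-! ### §1 Elementary geometry of `rotZ π`, the axis, and axisymmetric profiles -/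

/-- `‖e_z‖ = 1` (file-local copy). [folklore] -/
private theorem norm_eZ : ‖(eZ : EuclideanSpace ℝ (Fin 3))‖ = 1 := by
  simp [eZ]

/-- The rotation by `π` about the axis negates the first component (file-local; the tree has copies in other
routes' files, e.g. `PoloidalWindowDoorPoloidalWindowRigidityAxisymmetricMean.rotZ_pi_apply_zero`). [folklore] -/
private theorem rotZ_pi_apply_zero (v : EuclideanSpace ℝ (Fin 3)) : rotZ Real.pi v 0 = -v 0 := by
  simp

/-- The rotation by `π` about the axis negates the second component (file-local copy). [folklore] -/
private theorem rotZ_pi_apply_one (v : EuclideanSpace ℝ (Fin 3)) : rotZ Real.pi v 1 = -v 1 := by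
  simp

/-- The antipode about the axis is at distance twice the cylindrical radius: `‖R_π y - y‖ = 2 r(y)`. [folklore] -/
theorem norm_rotZ_pi_sub (y : EuclideanSpace ℝ (Fin 3)) : ‖rotZ Real.pi y - y‖ = 2 * cylRadius y := by
  have h1 : ‖rotZ Real.pi y - y‖ ^ 2 = (2 * cylRadius y) ^ 2 := by
    rw [EuclideanSpace.real_norm_sq_eq, Fin.sum_univ_three, mul_pow, cylRadius_sq]
    simp only [PiLp.sub_apply, rotZ_apply_zero, rotZ_apply_one, rotZ_apply_two, Real.cos_pi, Real.sin_pi]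
    ring
  exact (pow_left_inj₀ (norm_nonneg _) (mul_nonneg zero_le_two (cylRadius_nonneg y)) two_ne_zero).1 h1

/-- Points on the axis are fixed by every rotation about the axis (file-local copy of
`PoloidalWindowDoorPoloidalWindowRigidityOneSliceCurlAxisymmetric.rotZ_eq_self_of_horizontal_eq_zero`). [folklore] -/
private theorem rotZ_of_onAxis {y : EuclideanSpace ℝ (Fin 3)} (h0 : y 0 = 0) (h1 : y 1 = 0) (θ : ℝ) :
    rotZ θ y = y := by
  ext i
  fin_cases i <;> simp [h0, h1]

/-- **On the axis an axisymmetric field is vertical** (first component). [folklore] -/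
theorem apply_zero_eq_zero_of_onAxis {W : EuclideanSpace ℝ (Fin 3) → EuclideanSpace ℝ (Fin 3)}
    (hW : IsAxisymmetric W) {y : EuclideanSpace ℝ (Fin 3)} (h0 : y 0 = 0) (h1 : y 1 = 0) :
    W y 0 = 0 := by
  have h := hW Real.pi y
  rw [rotZ_of_onAxis h0 h1] at h
  have h' : W y 0 = -(W y 0) := by
    conv_lhs => rw [h]
    exact rotZ_pi_apply_zero _
  linarith

/-- **On the axis an axisymmetric field is vertical** (second component). [folklore] -/
theorem apply_one_eq_zero_of_onAxis {W : EuclideanSpace ℝ (Fin 3) → EuclideanSpace ℝ (Fin 3)}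
    (hW : IsAxisymmetric W) {y : EuclideanSpace ℝ (Fin 3)} (h0 : y 0 = 0) (h1 : y 1 = 0) :
    W y 1 = 0 := by
  have h := hW Real.pi y
  rw [rotZ_of_onAxis h0 h1] at h
  have h' : W y 1 = -(W y 1) := by
    conv_lhs => rw [h]
    exact rotZ_pi_apply_one _
  linarith

/-- The cylindrical radius is `1`-Lipschitz: `r(y) ≤ r(x) + ‖y - x‖` (file-local copy of
`Literature.Analysis.FluidPDE.cylRadius_le_cylRadius_add_norm_sub`, not imported to keep the cone light). [folklore] -/
private theorem cylRadius_le_add_norm_sub (x y : EuclideanSpace ℝ (Fin 3)) :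
    cylRadius y ≤ cylRadius x + ‖y - x‖ := by
  have key : ∀ v : EuclideanSpace ℝ (Fin 3),
      cylRadius v = ‖(WithLp.toLp 2 ![v 0, v 1] : EuclideanSpace ℝ (Fin 2))‖ := by
    intro v
    rw [cylRadius, EuclideanSpace.norm_eq]
    congr 1
    simp [Fin.sum_univ_two, sq_abs]
  have hD : ‖(WithLp.toLp 2 ![(y - x) 0, (y - x) 1] : EuclideanSpace ℝ (Fin 2))‖ ≤ ‖y - x‖ := by
    rw [EuclideanSpace.norm_eq, EuclideanSpace.norm_eq (y - x)]
    refine Real.sqrt_le_sqrt ?_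
    simp only [Fin.sum_univ_two, Fin.sum_univ_three, Real.norm_eq_abs, sq_abs,
      Matrix.cons_val_zero, Matrix.cons_val_one]
    nlinarith [sq_nonneg ((y - x) 2)]
  have hsum : (WithLp.toLp 2 ![y 0, y 1] : EuclideanSpace ℝ (Fin 2)) =
      WithLp.toLp 2 ![x 0, x 1] + WithLp.toLp 2 ![(y - x) 0, (y - x) 1] := by
    ext i
    fin_cases i <;> simp
  rw [key y, key x, hsum]
  exact (norm_add_le _ _).trans (add_le_add_right hD _)

/-- `e_z` and `e_x` are at distance `√2`: `‖e_z - e_x‖² = 2`. [folklore] -/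
theorem norm_eZ_sub_single_zero_sq :
    ‖(eZ : EuclideanSpace ℝ (Fin 3)) - EuclideanSpace.single 0 1‖ ^ 2 = 2 := by
  rw [EuclideanSpace.real_norm_sq_eq, Fin.sum_univ_three]
  simp [eZ]
  norm_num

/-! ### §2 Small quantitative lemmas (kept separate to stay within default heartbeats) -/

/-- Component bound from closeness when the profile component vanishes: `‖c•v - w‖ ≤ K⁻¹`, `w i = 0`, `c ≥ 1/6`
give `|v i|·K ≤ 6`. [folklore] -/
theorem abs_apply_mul_le_six {v w : EuclideanSpace ℝ (Fin 3)} {c K : ℝ} {i : Fin 3}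
    (hK : 0 < K) (hc : 6⁻¹ ≤ c) (hclose : ‖c • v - w‖ ≤ K⁻¹) (hi : w i = 0) : |v i| * K ≤ 6 := by
  have hc0 : 0 < c := lt_of_lt_of_le (by norm_num) hc
  have h := (PiLp.norm_apply_le (c • v - w) i).trans hclose
  rw [PiLp.sub_apply, PiLp.smul_apply, smul_eq_mul, hi, sub_zero, Real.norm_eq_abs, abs_mul,
    abs_of_pos hc0] at h
  have h' : c * |v i| * K ≤ 1 := by
    have := mul_le_mul_of_nonneg_right h hK.le
    rwa [inv_mul_cancel₀ hK.ne'] at this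
  nlinarith [mul_nonneg (abs_nonneg (v i)) hK.le]

/-- Component bound from two closeness relations with flipped profile components: `‖γ•v - w‖ ≤ K⁻¹`,
`‖γ'•v - w'‖ ≤ K⁻¹`, `w' i = -w i`, `γ ≥ 1/2`, `γ' ≥ 0` give `|v i|·K ≤ 4`. [folklore] -/
theorem abs_apply_mul_le_four {v w w' : EuclideanSpace ℝ (Fin 3)} {γ γ' K : ℝ} {i : Fin 3}
    (hK : 0 < K) (hγ : 2⁻¹ ≤ γ) (hγ' : 0 ≤ γ') (h1 : ‖γ • v - w‖ ≤ K⁻¹) (h2 : ‖γ' • v - w'‖ ≤ K⁻¹)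
    (hi : w' i = -(w i)) : |v i| * K ≤ 4 := by
  have h1' := (PiLp.norm_apply_le (γ • v - w) i).trans h1
  have h2' := (PiLp.norm_apply_le (γ' • v - w') i).trans h2
  rw [PiLp.sub_apply, PiLp.smul_apply, smul_eq_mul, Real.norm_eq_abs] at h1' h2'
  rw [hi] at h2'
  have h3 : |(γ + γ') * v i| ≤ 2 * K⁻¹ := by
    have h4 : (γ + γ') * v i = (γ * v i - w i) + (γ' * v i - -w i) := by ring
    rw [h4]
    exact (abs_add_le _ _).trans (by linarith)
  rw [abs_mul, abs_of_nonneg (by linarith : 0 ≤ γ + γ')] at h3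
  have h5 : (γ + γ') * |v i| * K ≤ 2 := by
    have := mul_le_mul_of_nonneg_right h3 hK.le
    rwa [mul_assoc 2, inv_mul_cancel₀ hK.ne', mul_one] at this
  nlinarith [mul_nonneg (abs_nonneg (v i)) hK.le]

/-- Two unit vectors at distance `√2` (i.e. orthogonal) cannot both have horizontal components of size `≤ 4/K`,
`≤ 6/K` when `K ≥ 25`. [folklore] -/
theorem false_of_orthonormal_nearVertical {aa b : EuclideanSpace ℝ (Fin 3)} {K : ℝ} (hK : 25 ≤ K)
    (haa : ‖aa‖ = 1) (hb : ‖b‖ = 1) (hab : ‖aa - b‖ ^ 2 = 2)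
    (haa0 : |aa 0| * K ≤ 4) (haa1 : |aa 1| * K ≤ 4) (hb0 : |b 0| * K ≤ 6) (hb1 : |b 1| * K ≤ 6) :
    False := by
  have n1 : aa 0 ^ 2 + aa 1 ^ 2 + aa 2 ^ 2 = 1 := by
    have h := EuclideanSpace.real_norm_sq_eq aa
    rw [haa, Fin.sum_univ_three] at h
    linarith
  have n2 : b 0 ^ 2 + b 1 ^ 2 + b 2 ^ 2 = 1 := by
    have h := EuclideanSpace.real_norm_sq_eq b
    rw [hb, Fin.sum_univ_three] at h
    linarith
  have n3 : (aa 0 - b 0) ^ 2 + (aa 1 - b 1) ^ 2 + (aa 2 - b 2) ^ 2 = 2 := by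
    have h := EuclideanSpace.real_norm_sq_eq (aa - b)
    rw [hab, Fin.sum_univ_three] at h
    simp only [PiLp.sub_apply] at h
    linarith
  have horth : aa 0 * b 0 + aa 1 * b 1 + aa 2 * b 2 = 0 := by
    linear_combination (n1 + n2 - n3) / 2
  have ea0 : |aa 0| ≤ 4 / 25 := by
    rw [le_div_iff₀ (by norm_num : (0:ℝ) < 25)]; nlinarith [abs_nonneg (aa 0)]
  have ea1 : |aa 1| ≤ 4 / 25 := by
    rw [le_div_iff₀ (by norm_num : (0:ℝ) < 25)]; nlinarith [abs_nonneg (aa 1)]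
  have eb0 : |b 0| ≤ 6 / 25 := by
    rw [le_div_iff₀ (by norm_num : (0:ℝ) < 25)]; nlinarith [abs_nonneg (b 0)]
  have eb1 : |b 1| ≤ 6 / 25 := by
    rw [le_div_iff₀ (by norm_num : (0:ℝ) < 25)]; nlinarith [abs_nonneg (b 1)]
  have sa0 : aa 0 ^ 2 ≤ (4 / 25) ^ 2 := by
    rw [← sq_abs]; exact pow_le_pow_left₀ (abs_nonneg _) ea0 2
  have sa1 : aa 1 ^ 2 ≤ (4 / 25) ^ 2 := by
    rw [← sq_abs]; exact pow_le_pow_left₀ (abs_nonneg _) ea1 2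
  have sb0 : b 0 ^ 2 ≤ (6 / 25) ^ 2 := by
    rw [← sq_abs]; exact pow_le_pow_left₀ (abs_nonneg _) eb0 2
  have sb1 : b 1 ^ 2 ≤ (6 / 25) ^ 2 := by
    rw [← sq_abs]; exact pow_le_pow_left₀ (abs_nonneg _) eb1 2
  have e1 : 1 - 2 * (4 / 25) ^ 2 ≤ aa 2 ^ 2 := by linarith
  have e2 : 1 - 2 * (6 / 25) ^ 2 ≤ b 2 ^ 2 := by linarith
  have e3 : |aa 2 * b 2| ≤ 2 * ((4 / 25) * (6 / 25)) := by
    have h : aa 2 * b 2 = -(aa 0 * b 0 + aa 1 * b 1) := by linarith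
    rw [h, abs_neg]
    refine (abs_add_le _ _).trans ?_
    rw [abs_mul, abs_mul]
    have := mul_le_mul ea0 eb0 (abs_nonneg _) (by norm_num)
    have := mul_le_mul ea1 eb1 (abs_nonneg _) (by norm_num)
    linarith
  have e4 : (aa 2 * b 2) ^ 2 ≤ (2 * ((4 / 25) * (6 / 25))) ^ 2 := by
    rw [← sq_abs]; exact pow_le_pow_left₀ (abs_nonneg _) e3 2
  have e5 : (1 - 2 * (4 / 25) ^ 2) * (1 - 2 * (6 / 25) ^ 2) ≤ (aa 2 * b 2) ^ 2 := by
    rw [mul_pow]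
    exact mul_le_mul e1 e2 (by norm_num) (sq_nonneg _)
  norm_num at e4 e5
  linarith

/-! ### §3 The core-plus-shell slice: sizes -/

/-- Sizes of the core-plus-shell slice: `‖f‖ ≤ V` everywhere, `3‖f‖ ≤ V` off the core `‖x‖ ≤ a`, and
`f 0 = V e_z`. [folklore] -/
theorem shellSpoiler_sizes
    {f : EuclideanSpace ℝ (Fin 3) → EuclideanSpace ℝ (Fin 3)} {a D V : ℝ}
    (ha : 0 < a) (hV : 0 < V)
    (f1 : ∀ x, ‖x‖ ≤ a → f x = (V * max 0 (1 - ‖x‖ / a)) • (eZ : EuclideanSpace ℝ (Fin 3)))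
    (f2 : ∀ x, a < ‖x‖ → ‖x‖ < D → f x = 0)
    (f3 : ∀ x, D ≤ ‖x‖ → ‖x‖ ≤ 2 * D → f x = (V / 3) • EuclideanSpace.single 0 1)
    (f4 : ∀ x, 2 * D < ‖x‖ → f x = 0) :
    (∀ x, ‖f x‖ ≤ V) ∧ (∀ x, a < ‖x‖ → 3 * ‖f x‖ ≤ V) ∧ f 0 = V • (eZ : EuclideanSpace ℝ (Fin 3)) := by
  have hsingle : ‖(EuclideanSpace.single (0 : Fin 3) (1 : ℝ))‖ = 1 := by simp
  have hoff : ∀ x, a < ‖x‖ → 3 * ‖f x‖ ≤ V := by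
    intro x h1
    by_cases h2 : ‖x‖ < D
    · rw [f2 x h1 h2, norm_zero, mul_zero]; exact hV.le
    · push Not at h2
      by_cases h3 : ‖x‖ ≤ 2 * D
      · rw [f3 x h2 h3, norm_smul, Real.norm_of_nonneg (by positivity), hsingle, mul_one]
        linarith
      · push Not at h3
        rw [f4 x h3, norm_zero, mul_zero]; exact hV.le
  refine ⟨fun x => ?_, hoff, ?_⟩
  · by_cases h1 : ‖x‖ ≤ a
    · rw [f1 x h1, norm_smul, norm_eZ, mul_one, Real.norm_of_nonneg (by positivity)]
      refine mul_le_of_le_one_right hV.le (max_le zero_le_one ?_)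
      linarith [div_nonneg (norm_nonneg x) ha.le]
    · push Not at h1
      linarith [hoff x h1, norm_nonneg (f x)]
  · rw [f1 0 (by rw [norm_zero]; exact ha.le), norm_zero, zero_div, sub_zero, max_eq_right zero_le_one, mul_one]

end MonopoleAnchorObstruction

end Summit.NavierStokesRegularity.NavierStokesRegularity.Theorems

end
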